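import Literature.AnabelianGeometry.SemiGraphs.CoveringRestrictComparison
import Literature.AnabelianGeometry.SemiGraphs.CoveringFaithful
import Literature.AnabelianGeometry.SemiGraphs.GraphOfAnabelioidsGalois
import Literature.AnabelianGeometry.SemiGraphs.PullbackFunctorExact
import Literature.AnabelianGeometry.Anabelioids.ComponentsOrbits
import Literature.AnabelianGeometry.Anabelioids.FibrePullbackLemmas

/-!
# Restricting the covering `𝒢_A → 𝒢` to a preimage component — proofs, I: fibres and the counit

Mochizuki, *Semi-graphs of anabelioids*, Publ. RIMS **42** (2006) 221–322, §2, proof of Corollary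
2.7 (i), author's manuscript p. 30 [cite: MochizukiSemiAnbd2006, Cor. 2.7(i) p.30]: "`ℋ′` injects into
`𝒢′` as a subgraph" — the components `ℋ″` of the restriction `ℋ′ → ℍ` of the covering `𝒢′ → 𝒢`
attached to `A` are finite étale coverings of `𝒢_ℍ` attached to sub-objects of `A|_ℍ`.

PROOF-ONLY companion of `CoveringRestrictComparison.lean` (abc-iut-L3-d3; cell row RS-cov of the
(D3) dictionary of `FiniteEtaleCoveringDictionary.lean`).  Throughout, `φ := A.coveringHomCan`,
`ℍ ⊆ 𝔾` a sub-semi-graph, `K ⊆ 𝔾_A` over `ℍ`, and `m : Z ↪ A|_ℍ` a sub-object of `B(𝒢_ℍ)` whose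
fibre-image at each vertex / edge of `ℍ` is the union of the fibre-images of the components of `S_w` /
`T_e` indexing the vertices / edges of `K` (the output of abc-iut-L6-t17's
`exists_preimageComponentObject`).  Contents:

* (fibre tools in an abstract Galois category: `Anabelioids/FibrePullbackLemmas.lean`);
* for the covering semi-graph `𝔾_{A|_ℍ}`: the components of abc-iut-L3-t5's comparison functor
  `(A|_ℍ).toCovering` on objects `X → Z → A|_ℍ` are INITIAL off `K`
  (`isEmpty_fiber_toCoveringV_of_not_mem`, `…E…`), whence `restrictComparison m` is FAITHFUL
  (`restrictComparison_faithful`); and `(A|_ℍ).toCovering` followed by restriction to `K` inverts the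
  counit `Y ×_{A|_ℍ} Z → Y` of `Over.map m ⊣ Over.pullback m` (`isIso_reindexRestrict_map_counit`) —
  the engine of both the essential surjectivity of `restrictComparison m` and of the identification
  `(φ|_K)^* ≅ (Z × −) ⋙ restrictComparison m` (part II).

Nothing here takes a side on [IUTchIII] Cor. 3.12; typed ≠ discharged.
-/

namespace Literature.AnabelianGeometry.SemiGraphs

open CategoryTheory CategoryTheory.Limits CategoryTheory.PreGaloisCategory
open Literature.AnabelianGeometry.Anabelioids

universe w v₂ u₂ v₁ u₁ u

-- Mathlib's `Over.pullback` simp lemmas (`pullback.lift_fst`, …) only fire under the pre-v4.2x defeq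
-- transparency behaviour, exactly as in `Mathlib/CategoryTheory/Comma/Over/Pullback.lean`.
set_option backward.isDefEq.respectTransparency false

namespace SemiGraphOfAnabelioids

namespace BObj

variable {𝒢 : SemiGraphOfAnabelioids.{v₁, u₁, u}} (A : 𝒢.BObj) (H : 𝒢.graph.Subgraph)
  (K : A.coveringGraph.graph.Subgraph)
  (hV : K.verts ⊆ A.fibreData.proj.vertexMap ⁻¹' H.verts)
  (hE : K.edges ⊆ A.fibreData.proj.edgeMap ⁻¹' H.edges)
  {Z : (𝒢.restrict H).BObj} (m : Z ⟶ (𝒢.restrictFunctor H).obj A)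
  (hmS : ∀ (w : H.toSemiGraph.Vertex) (Fw : 𝒢.V w.1 ⥤ FintypeCat.{v₁}) [FiberFunctor Fw]
      (y : Fw.obj (A.S w.1)),
    y ∈ Set.range (Fw.map (m.fS w)) ↔ ∃ c : Shrink.{u} (π₀Obj (A.S w.1)),
      (⟨w.1, c⟩ : A.fibreData.total.Vertex) ∈ K.verts ∧
        y ∈ Set.range (Fw.map (A.vComp ⟨w.1, c⟩).1.arrow))
  (hmT : ∀ (e : H.toSemiGraph.Edge) (Fe : 𝒢.E e.1 ⥤ FintypeCat.{v₁}) [FiberFunctor Fe]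
      (x : Fe.obj (A.T e.1)),
    x ∈ Set.range (Fe.map (m.fT e)) ↔ ∃ c : Shrink.{u} (π₀Obj (A.T e.1)),
      (⟨e.1, c⟩ : A.fibreData.total.Edge) ∈ K.edges ∧
        x ∈ Set.range (Fe.map (A.eComp ⟨e.1, c⟩).1.arrow))

/-! ### The fibre-image of `Z` against the components indexing `K` -/

section Ranges

include hmS in
/-- Over a vertex of `K`, the component lies under `Z`. [cite: MochizukiSemiAnbd2006, Cor. 2.7(i) p.30] -/
theorem range_vComp_subset_of_mem (w : H.toSemiGraph.Vertex) (c : Shrink.{u} (π₀Obj (A.S w.1)))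
    (hc : (⟨w.1, c⟩ : A.fibreData.total.Vertex) ∈ K.verts) (Fw : 𝒢.V w.1 ⥤ FintypeCat.{v₁})
    [FiberFunctor Fw] :
    Set.range (Fw.map (A.vComp ⟨w.1, c⟩).1.arrow) ⊆ Set.range (Fw.map (m.fS w)) :=
  fun _ hy => (hmS w Fw _).mpr ⟨c, hc, hy⟩

include hmS in
/-- Over a vertex of `𝔾_A` over `ℍ` NOT in `K`, the component avoids `Z`.
[cite: MochizukiSemiAnbd2006, Cor. 2.7(i) p.30] -/
theorem not_mem_range_of_not_mem (w : H.toSemiGraph.Vertex) (c : Shrink.{u} (π₀Obj (A.S w.1)))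
    (hc : (⟨w.1, c⟩ : A.fibreData.total.Vertex) ∉ K.verts) (Fw : 𝒢.V w.1 ⥤ FintypeCat.{v₁})
    [FiberFunctor Fw] :
    ∀ y ∈ Set.range (Fw.map (A.vComp ⟨w.1, c⟩).1.arrow), y ∉ Set.range (Fw.map (m.fS w)) := by
  intro y hy hym
  obtain ⟨c', hc', hy'⟩ := (hmS w Fw y).mp hym
  have heq : A.vComp ⟨w.1, c'⟩ = A.vComp ⟨w.1, c⟩ := component_eq_of_mem_range Fw _ _ hy' hy
  have hcc : c' = c := (equivShrink _).symm.injective heq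
  exact hc (hcc ▸ hc')

include hmT in
/-- Over an edge of `K`, the component lies under `Z`. [cite: MochizukiSemiAnbd2006, Cor. 2.7(i) p.30] -/
theorem range_eComp_subset_of_mem (e : H.toSemiGraph.Edge) (c : Shrink.{u} (π₀Obj (A.T e.1)))
    (hc : (⟨e.1, c⟩ : A.fibreData.total.Edge) ∈ K.edges) (Fe : 𝒢.E e.1 ⥤ FintypeCat.{v₁})
    [FiberFunctor Fe] :
    Set.range (Fe.map (A.eComp ⟨e.1, c⟩).1.arrow) ⊆ Set.range (Fe.map (m.fT e)) :=
  fun _ hx => (hmT e Fe _).mpr ⟨c, hc, hx⟩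

include hmT in
/-- Over an edge of `𝔾_A` over `ℍ` NOT in `K`, the component avoids `Z`.
[cite: MochizukiSemiAnbd2006, Cor. 2.7(i) p.30] -/
theorem not_mem_rangeE_of_not_mem (e : H.toSemiGraph.Edge) (c : Shrink.{u} (π₀Obj (A.T e.1)))
    (hc : (⟨e.1, c⟩ : A.fibreData.total.Edge) ∉ K.edges) (Fe : 𝒢.E e.1 ⥤ FintypeCat.{v₁})
    [FiberFunctor Fe] :
    ∀ x ∈ Set.range (Fe.map (A.eComp ⟨e.1, c⟩).1.arrow), x ∉ Set.range (Fe.map (m.fT e)) := by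
  intro x hx hxm
  obtain ⟨c', hc', hx'⟩ := (hmT e Fe x).mp hxm
  have heq : A.eComp ⟨e.1, c'⟩ = A.eComp ⟨e.1, c⟩ := component_eq_of_mem_range Fe _ _ hx' hx
  have hcc : c' = c := (equivShrink _).symm.injective heq
  exact hc (hcc ▸ hc')

end Ranges

/-! ### The components of `(A|_ℍ).toCovering` on objects over `Z` are initial off `K` -/

section OffK

include hmS in
/-- Off `K`, the vertex component `X_w ×_{S_w} P` of `toCovering (X → Z → A|_ℍ)` has empty fibre.
[cite: MochizukiSemiAnbd2006, Cor. 2.7(i) p.30] -/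
theorem isEmpty_fiber_toCoveringV_of_not_mem (Y : Over Z)
    (vc : ((𝒢.restrictFunctor H).obj A).fibreData.total.Vertex)
    (hvc : (⟨vc.1.1, vc.2⟩ : A.fibreData.total.Vertex) ∉ K.verts)
    (Fw : 𝒢.V vc.1.1 ⥤ FintypeCat.{v₁}) [FiberFunctor Fw] :
    IsEmpty (Fw.obj ((((𝒢.restrictFunctor H).obj A).toCoveringV vc).obj ((Over.map m).obj Y)).left) := by
  change IsEmpty (Fw.obj (pullback ((Y.hom ≫ m).fS vc.1) (A.vComp ⟨vc.1.1, vc.2⟩).1.arrow))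
  exact isEmpty_fiber_pullback_of_disjoint Fw (m.fS vc.1) (Y.hom.fS vc.1) _
    (A.not_mem_range_of_not_mem H K m hmS vc.1 vc.2 hvc Fw)

include hmT in
/-- Off `K`, the edge component `X_e ×_{T_e} Q` of `toCovering (X → Z → A|_ℍ)` has empty fibre.
[cite: MochizukiSemiAnbd2006, Cor. 2.7(i) p.30] -/
theorem isEmpty_fiber_toCoveringE_of_not_mem (Y : Over Z)
    (ec : ((𝒢.restrictFunctor H).obj A).fibreData.total.Edge)
    (hec : (⟨ec.1.1, ec.2⟩ : A.fibreData.total.Edge) ∉ K.edges)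
    (Fe : 𝒢.E ec.1.1 ⥤ FintypeCat.{v₁}) [FiberFunctor Fe] :
    IsEmpty (Fe.obj ((((𝒢.restrictFunctor H).obj A).toCoveringE ec).obj ((Over.map m).obj Y)).left) := by
  change IsEmpty (Fe.obj (pullback ((Y.hom ≫ m).fT ec.1) (A.eComp ⟨ec.1.1, ec.2⟩).1.arrow))
  exact isEmpty_fiber_pullback_of_disjoint Fe (m.fT ec.1) (Y.hom.fT ec.1) _
    (A.not_mem_rangeE_of_not_mem H K m hmT ec.1 ec.2 hec Fe)

include hmS in
/-- Off `K`, the vertex object of `toCovering (X → Z → A|_ℍ)` (in the model `Shrink (Over P)`) is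
initial. [cite: MochizukiSemiAnbd2006, Cor. 2.7(i) p.30] -/
theorem nonempty_isInitial_S_of_not_mem (Y : Over Z)
    (vc : ((𝒢.restrictFunctor H).obj A).fibreData.total.Vertex)
    (hvc : (⟨vc.1.1, vc.2⟩ : A.fibreData.total.Vertex) ∉ K.verts) :
    Nonempty (IsInitial ((((𝒢.restrictFunctor H).obj A).toCovering.obj ((Over.map m).obj Y)).S vc)) := by
  let Fw := GaloisCategory.getFiberFunctor (𝒢.V vc.1.1)
  haveI := A.isEmpty_fiber_toCoveringV_of_not_mem H K m hmS Y vc hvc Fw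
  obtain ⟨h0⟩ := (initial_iff_fiber_empty Fw _).mpr ‹_›
  obtain ⟨h1⟩ := nonempty_isInitial_over_of_left _ h0
  haveI : (((𝒢.restrictFunctor H).obj A).toV vc).IsEquivalence :=
    Equivalence.isEquivalence_functor _
  exact ⟨h1.isInitialObj (((𝒢.restrictFunctor H).obj A).toV vc)⟩

include hmT in
/-- Off `K`, the edge object of `toCovering (X → Z → A|_ℍ)` is initial.
[cite: MochizukiSemiAnbd2006, Cor. 2.7(i) p.30] -/
theorem nonempty_isInitial_T_of_not_mem (Y : Over Z)
    (ec : ((𝒢.restrictFunctor H).obj A).fibreData.total.Edge)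
    (hec : (⟨ec.1.1, ec.2⟩ : A.fibreData.total.Edge) ∉ K.edges) :
    Nonempty (IsInitial ((((𝒢.restrictFunctor H).obj A).toCovering.obj ((Over.map m).obj Y)).T ec)) := by
  let Fe := GaloisCategory.getFiberFunctor (𝒢.E ec.1.1)
  haveI := A.isEmpty_fiber_toCoveringE_of_not_mem H K m hmT Y ec hec Fe
  obtain ⟨h0⟩ := (initial_iff_fiber_empty Fe _).mpr ‹_›
  obtain ⟨h1⟩ := nonempty_isInitial_over_of_left _ h0
  haveI : (((𝒢.restrictFunctor H).obj A).toE ec).IsEquivalence :=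
    Equivalence.isEquivalence_functor _
  exact ⟨h1.isInitialObj (((𝒢.restrictFunctor H).obj A).toE ec)⟩

end OffK

/-! ### `restrictComparison m` is faithful -/

include hmS hmT in
/-- Two morphisms over `Z` with the same image under `restrictComparison m` already have the same image
under `toCovering ∘ Over.map m`: on `K` by hypothesis, off `K` because the source is initial.
[cite: MochizukiSemiAnbd2006, Cor. 2.7(i) p.30] -/
theorem toCovering_map_eq_of_restrictComparison_map_eq {Y Y' : Over Z} (g₁ g₂ : Y ⟶ Y')
    (h : (A.restrictComparison H K hV hE m).map g₁ = (A.restrictComparison H K hV hE m).map g₂) :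
    ((𝒢.restrictFunctor H).obj A).toCovering.map ((Over.map m).map g₁) =
      ((𝒢.restrictFunctor H).obj A).toCovering.map ((Over.map m).map g₂) := by
  refine BObj.hom_ext _ _ (funext fun vc => ?_) (funext fun ec => ?_)
  · by_cases hvc : (⟨vc.1.1, vc.2⟩ : A.fibreData.total.Vertex) ∈ K.verts
    · exact congrArg (fun k => BObj.Hom.fS k (⟨⟨vc.1.1, vc.2⟩, hvc⟩ : (A.coveringGraph.restrict K).graph.Vertex)) h
    · obtain ⟨hI⟩ := A.nonempty_isInitial_S_of_not_mem H K m hmS Y vc hvc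
      exact hI.hom_ext _ _
  · by_cases hec : (⟨ec.1.1, ec.2⟩ : A.fibreData.total.Edge) ∈ K.edges
    · exact congrArg (fun k => BObj.Hom.fT k (⟨⟨ec.1.1, ec.2⟩, hec⟩ : (A.coveringGraph.restrict K).graph.Edge)) h
    · obtain ⟨hI⟩ := A.nonempty_isInitial_T_of_not_mem H K m hmT Y ec hec
      exact hI.hom_ext _ _

include hmS hmT in
/-- **`restrictComparison m : Over Z ⥤ B(𝒢_A|_K)` is faithful.** [cite: MochizukiSemiAnbd2006, Cor. 2.7(i) p.30] -/
theorem restrictComparison_faithful : (A.restrictComparison H K hV hE m).Faithful := by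
  refine ⟨fun {Y Y'} g₁ g₂ h => ?_⟩
  have h1 := A.toCovering_map_eq_of_restrictComparison_map_eq H K hV hE m hmS hmT g₁ g₂ h
  have h2 : (Over.map m).map g₁ = (Over.map m).map g₂ :=
    (((𝒢.restrictFunctor H).obj A).toCovering_faithful).map_injective h1
  exact Over.OverMorphism.ext (by simpa using congrArg CommaMorphism.left h2)

/-! ### `toCovering` then restriction to `K` inverts the counit of `Over.map m ⊣ Over.pullback m` -/

section Counit

variable (hH : H.toSemiGraph.IsConnected) [Mono m] [HasPullbacks (𝒢.restrict H).BObj]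

include hH hmS hmT in
/-- **The counit `Y ×_{A|_ℍ} Z → Y` becomes an isomorphism after `toCovering` and restriction to `K`**:
its component at a vertex `(w, P) ∈ K` is `(Y ×_{A|_ℍ} Z)_w ×_{S_w} P → Y_w ×_{S_w} P`, an isomorphism
by the base-change lemma since `P` lies under `Z`; same at the edges of `K`.
[cite: MochizukiSemiAnbd2006, Cor. 2.7(i) p.30] -/
theorem isIso_reindexRestrict_map_counit (Y : Over ((𝒢.restrictFunctor H).obj A)) :
    IsIso ((A.reindexRestrict H K hV hE).map (((𝒢.restrictFunctor H).obj A).toCovering.map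
      ((Over.mapPullbackAdj m).counit.app Y))) := by
  letI := (𝒢.restrict H).preGaloisCategory_bObj
  have hH' : (𝒢.restrict H).IsConnected := ⟨hH⟩
  letI := (𝒢.restrict H).galoisCategory_bObj hH'
  have hεl : ((Over.mapPullbackAdj m).counit.app Y).left = pullback.fst Y.hom m := by
    rw [Over.mapPullbackAdj_counit_app]
    simp
  refine BObj.isIso_of_components _ (fun kc => ?_) (fun ke => ?_)
  · -- vertex components
    obtain ⟨⟨v, c⟩, hvc⟩ := kc
    let w : H.toSemiGraph.Vertex := ⟨v, hV hvc⟩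
    let Fw := GaloisCategory.getFiberFunctor (𝒢.V v)
    haveI : FiberFunctor Fw := inferInstanceAs (FiberFunctor (GaloisCategory.getFiberFunctor _))
    haveI : FiberFunctor ((𝒢.restrict H).ρ w ⋙ Fw) := (𝒢.restrict H).fiberFunctor_ρ hH' w Fw
    haveI : PreservesLimitsOfShape WalkingCospan ((𝒢.restrict H).ρ w) :=
      ((𝒢.restrict H).hasLimitsOfShape_bObj (J := WalkingCospan)).2.1 w
    change IsIso ((((𝒢.restrictFunctor H).obj A).toV ⟨w, c⟩).map
      ((((𝒢.restrictFunctor H).obj A).toCoveringV ⟨w, c⟩).map ((Over.mapPullbackAdj m).counit.app Y)))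
    suffices hl : IsIso ((((𝒢.restrictFunctor H).obj A).toCoveringV ⟨w, c⟩).map
        ((Over.mapPullbackAdj m).counit.app Y)).left by
      haveI : IsIso ((Over.forget _).map ((((𝒢.restrictFunctor H).obj A).toCoveringV ⟨w, c⟩).map
          ((Over.mapPullbackAdj m).counit.app Y))) := hl
      haveI : IsIso ((((𝒢.restrictFunctor H).obj A).toCoveringV ⟨w, c⟩).map
          ((Over.mapPullbackAdj m).counit.app Y)) :=
        isIso_of_reflects_iso _ (Over.forget _)
      haveI : (((𝒢.restrictFunctor H).obj A).toV ⟨w, c⟩).IsEquivalence :=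
        Equivalence.isEquivalence_functor _
      infer_instance
    have hcond : pullback.fst Y.hom m ≫ Y.hom = pullback.snd Y.hom m ≫ m := pullback.condition
    have h₁ : (pullback.snd Y.hom m ≫ m).fS w ≫ 𝟙 _ = (pullback.fst Y.hom m).fS w ≫ Y.hom.fS w := by
      rw [Category.comp_id]; exact (congrArg (fun k => BObj.Hom.fS k w) hcond).symm
    have h₂ : (A.vComp ⟨v, c⟩).1.arrow ≫ 𝟙 _ = 𝟙 _ ≫ (A.vComp ⟨v, c⟩).1.arrow := by
      rw [Category.comp_id, Category.id_comp]
    have key : IsIso (pullback.map ((pullback.snd Y.hom m ≫ m).fS w) (A.vComp ⟨v, c⟩).1.arrow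
        (Y.hom.fS w) (A.vComp ⟨v, c⟩).1.arrow ((pullback.fst Y.hom m).fS w) (𝟙 _) (𝟙 _) h₁ h₂) :=
      isIso_pullback_map_of_range_subset ((𝒢.restrict H).ρ w) Fw Y.hom m
        (fun a z h => exists_fiber_pullback ((𝒢.restrict H).ρ w ⋙ Fw) Y.hom m a z h)
        (A.vComp ⟨v, c⟩) (A.range_vComp_subset_of_mem H K m hmS w c hvc Fw)
        ((pullback.snd Y.hom m ≫ m).fS w) rfl h₁ h₂
    have heq : ((((𝒢.restrictFunctor H).obj A).toCoveringV ⟨w, c⟩).map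
        ((Over.mapPullbackAdj m).counit.app Y)).left =
        pullback.map ((pullback.snd Y.hom m ≫ m).fS w) (A.vComp ⟨v, c⟩).1.arrow
          (Y.hom.fS w) (A.vComp ⟨v, c⟩).1.arrow ((pullback.fst Y.hom m).fS w) (𝟙 _) (𝟙 _) h₁ h₂ := by
      apply pullback.hom_ext
      · rw [toCoveringV_map_left_fst, hεl]
        exact (pullback.lift_fst _ _ _).symm
      · rw [toCoveringV_map_left_snd]
        exact ((pullback.lift_snd _ _ _).trans (Category.comp_id _)).symm
    rw [heq]
    exact key
  · -- edge components
    obtain ⟨⟨f, c⟩, hfc⟩ := ke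
    let e : H.toSemiGraph.Edge := ⟨f, hE hfc⟩
    let Fe := GaloisCategory.getFiberFunctor (𝒢.E f)
    haveI : FiberFunctor Fe := inferInstanceAs (FiberFunctor (GaloisCategory.getFiberFunctor _))
    haveI : FiberFunctor ((𝒢.restrict H).ρE e ⋙ Fe) := (𝒢.restrict H).fiberFunctor_ρE hH' e Fe
    haveI : PreservesLimitsOfShape WalkingCospan ((𝒢.restrict H).ρE e) :=
      ((𝒢.restrict H).hasLimitsOfShape_bObj (J := WalkingCospan)).2.2 e
    change IsIso ((((𝒢.restrictFunctor H).obj A).toE ⟨e, c⟩).map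
      ((((𝒢.restrictFunctor H).obj A).toCoveringE ⟨e, c⟩).map ((Over.mapPullbackAdj m).counit.app Y)))
    suffices hl : IsIso ((((𝒢.restrictFunctor H).obj A).toCoveringE ⟨e, c⟩).map
        ((Over.mapPullbackAdj m).counit.app Y)).left by
      haveI : IsIso ((Over.forget _).map ((((𝒢.restrictFunctor H).obj A).toCoveringE ⟨e, c⟩).map
          ((Over.mapPullbackAdj m).counit.app Y))) := hl
      haveI : IsIso ((((𝒢.restrictFunctor H).obj A).toCoveringE ⟨e, c⟩).map
          ((Over.mapPullbackAdj m).counit.app Y)) :=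
        isIso_of_reflects_iso _ (Over.forget _)
      haveI : (((𝒢.restrictFunctor H).obj A).toE ⟨e, c⟩).IsEquivalence :=
        Equivalence.isEquivalence_functor _
      infer_instance
    have hcond : pullback.fst Y.hom m ≫ Y.hom = pullback.snd Y.hom m ≫ m := pullback.condition
    have h₁ : (pullback.snd Y.hom m ≫ m).fT e ≫ 𝟙 _ = (pullback.fst Y.hom m).fT e ≫ Y.hom.fT e := by
      rw [Category.comp_id]; exact (congrArg (fun k => BObj.Hom.fT k e) hcond).symm
    have h₂ : (A.eComp ⟨f, c⟩).1.arrow ≫ 𝟙 _ = 𝟙 _ ≫ (A.eComp ⟨f, c⟩).1.arrow := by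
      rw [Category.comp_id, Category.id_comp]
    have key : IsIso (pullback.map ((pullback.snd Y.hom m ≫ m).fT e) (A.eComp ⟨f, c⟩).1.arrow
        (Y.hom.fT e) (A.eComp ⟨f, c⟩).1.arrow ((pullback.fst Y.hom m).fT e) (𝟙 _) (𝟙 _) h₁ h₂) :=
      isIso_pullback_map_of_range_subset ((𝒢.restrict H).ρE e) Fe Y.hom m
        (fun a z h => exists_fiber_pullback ((𝒢.restrict H).ρE e ⋙ Fe) Y.hom m a z h)
        (A.eComp ⟨f, c⟩) (A.range_eComp_subset_of_mem H K m hmT e c hfc Fe)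
        ((pullback.snd Y.hom m ≫ m).fT e) rfl h₁ h₂
    have heq : ((((𝒢.restrictFunctor H).obj A).toCoveringE ⟨e, c⟩).map
        ((Over.mapPullbackAdj m).counit.app Y)).left =
        pullback.map ((pullback.snd Y.hom m ≫ m).fT e) (A.eComp ⟨f, c⟩).1.arrow
          (Y.hom.fT e) (A.eComp ⟨f, c⟩).1.arrow ((pullback.fst Y.hom m).fT e) (𝟙 _) (𝟙 _) h₁ h₂ := by
      apply pullback.hom_ext
      · rw [toCoveringE_map_left_fst, hεl]
        exact (pullback.lift_fst _ _ _).symm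
      · rw [toCoveringE_map_left_snd]
        exact ((pullback.lift_snd _ _ _).trans (Category.comp_id _)).symm
    rw [heq]
    exact key

end Counit

end BObj

end SemiGraphOfAnabelioids

end Literature.AnabelianGeometry.SemiGraphs
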